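import Mathlib
import HarnessLib
import Summits.HubbardSuperconductivity.HubbardSuperconductivity.Theorems.KLProgrammeKLRegimeEngineStepValuesResidueV17F2
import Summits.HubbardSuperconductivity.HubbardSuperconductivity.Theorems.KLProgrammeKLRegimeEngineV8DefsG14

/-!
# Route `KLProgramme` — ENGINE item stmt-HubbardSuperconductivity-20437 `KLRegimeEngineV17F2`, stub (c) `stub_engine_step_values`:
# THE VALUE-LANE CLOSER AT AN ARBITRARY PACKAGE `G`, with instances at the token of record `klEngGeo11` and the AMENDMENT-24/25 candidates
# `klEngGeo13` / `klEngGeo14` (cell gate-hubbard-kl, seat hubbard-kl-k3c2-p2 g21)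

WHY.  The stub-(c) closers of this lineage (`klvrF_stepValues_of_reduced`, `…_klEng7`, `…_klEng6raise`, `stepValuesV17F2_of_residue_*_Q/_gen`) are keyed at
`klEngGeo6` / `klEngGeo7 = klEngGeo6.raiseE4 _` / `klEngGeo6.raise T E`.  The REGISTERED (c) text (v2 FREEZE, skeleton b755cc8a5feed069) is keyed at `klEngGeo11`, and
p1b g16's A24 renders (r15-A24-G13 / -G14) at `klEngGeo13` / `klEngGeo14` — packages reached from `klEngGeo7` by `raiseE4`, `addShellLog`, `raiseCF`, `addTwoShell`,
`scaleGains`, `addShellLogPP`, none of which is a `raise`.  No value-lane closer existed at these tokens.  Since the assembly `klvrF2_stepValues_of_parts` and the in-class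
row `klvrF_pairValueIncrement_inClass` (…ValueClausesV17FLadder) are ALREADY generic in `G` modulo ONE package line
`G.aplus·G.ζ(n−1) + 10·G.bhi ≤ G.ppGain n |Qm|_𝕋` (in class), this file states the closer once for every `G` and proves the package line along the token chain:
* §1 `GeoConsts.package_ineq_of_ppGain_le` (the line transfers along `ppGain ≤`, `aplus/ζ/bhi =`) ⇒ **`klg11/klg13/klg14_package_ineq_of_isPairClassAt`**
  (from `klg7_…`: `G8–G10` leave `ppGain` untouched, `G11 = G10.addTwoShell klTSA`, `G13 = (G11.scaleGains 2).addShellLogPP klXSA`, `G14.ppGain = G13.ppGain`);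
* §2 generic closers (smallness lines as hypotheses, like §4 `_gen` of …StepValuesResidueV17F2): **`klvrF_stepValues_of_reduced_G`** (reduced list: (E2-F2)ₙ `hlad`,
  (B1-F) array at `n−1`, out-of-class rows `hout`, (E5-F)ₙ), `klvrF_pairValueIncrement_inClass_G`, **`stepValuesV17F2_of_residue_G`** (history-keyed),
  **`stepValuesV17F2_of_residue_sameFrame_G`** (`hout` split into same-frame rows + frame shift), `stepValuesV17F2_of_residue_towerLine_G` ((E5-F)ₙ from the iso door's
  inputs), `stepValuesV17F2_band_of_le_CF_G` (thermal band from one sign-blind bound, `Cp·4^T ≤ G.CF`);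
* §3 the instances **`stepValuesV17F2_of_residue(_sameFrame)_klEngGeo11 / _klEngGeo13 / _klEngGeo14`** — one `exact` for §Z-c at the registered token and at either
  A24 render; the (E2-F2)ₙ / (E5-F)ₙ inputs produced at `klEngGeo11` lift to `13/14` by `pairLadderStepAtV17F2_mono` / `isoTupleL1AtV17F_mono` (…SlotsV17FMono) —
  `hlad` MUST be fed at the conclusion's package (the in-class rows are derived from it there).
Compositions of landed lemmas; nothing about the model is asserted; nothing asserts (c), (E2″-F), K3 or superconductivity.  0 kit · 0 lit.
-/

noncomputable section

namespace Summit.HubbardSuperconductivity.HubbardSuperconductivity.Theorems.KLRegimeSplit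

set_option linter.dupNamespace false -- summit = problem name (single-conjunct summit), D-0017

open Real Finset Literature.MathematicalPhysics.QuantumLattice Literature.Probability.LatticeModels
open Summit.HubbardSuperconductivity.HubbardSuperconductivity.Theorems.KLProgrammeLegKernels
open Summit.HubbardSuperconductivity.HubbardSuperconductivity.Theorems.EngineV8

/-! ## §1 The package line along the token chain -/

/-- **The in-class package line transfers along `ppGain ≤` with `aplus, ζ, bhi` equal.** -/
theorem GeoConsts.package_ineq_of_ppGain_le {G G' : GeoConsts} {n : ℕ} {ρ : ℝ} (hpp : G.ppGain n ρ ≤ G'.ppGain n ρ) (ha : G'.aplus = G.aplus)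
    (hζ : G'.ζ = G.ζ) (hb : G'.bhi = G.bhi) (h : G.aplus * G.ζ (n - 1) + 10 * G.bhi ≤ G.ppGain n ρ) :
    G'.aplus * G'.ζ (n - 1) + 10 * G'.bhi ≤ G'.ppGain n ρ := by
  rw [ha, hζ, hb]; exact h.trans hpp

variable {L : ℕ}

/-- **The package line HOLDS at `klEngGeo11` in the pair class** (`G8–G10` keep `klEngGeo7`'s `ppGain`; `addTwoShell klTSA` only adds). -/
theorem klg11_package_ineq_of_isPairClassAt {Qm : TorusSite 2 L} (n : ℕ) (hQm : IsPairClassAt L Qm n) :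
    klEngGeo11.aplus * klEngGeo11.ζ (n - 1) + 10 * klEngGeo11.bhi ≤ klEngGeo11.ppGain n (klTorusNorm L Qm) := by
  have h7 := klg7_package_ineq_of_isPairClassAt n hQm
  have hpp := klEngGeo10_ppGain_le_klEngGeo11_ppGain n (klTorusNorm L Qm)
  have e10 : klEngGeo10.ppGain = klEngGeo7.ppGain := rfl
  rw [e10] at hpp
  exact GeoConsts.package_ineq_of_ppGain_le hpp rfl rfl rfl h7

/-- **The package line HOLDS at `klEngGeo13` in the pair class.** -/
theorem klg13_package_ineq_of_isPairClassAt {Qm : TorusSite 2 L} (n : ℕ) (hQm : IsPairClassAt L Qm n) :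
    klEngGeo13.aplus * klEngGeo13.ζ (n - 1) + 10 * klEngGeo13.bhi ≤ klEngGeo13.ppGain n (klTorusNorm L Qm) :=
  GeoConsts.package_ineq_of_ppGain_le (klEngGeo11_ppGain_le_klEngGeo13_ppGain n _) klEngGeo13_aplus klEngGeo13_ζ klEngGeo13_bhi
    (klg11_package_ineq_of_isPairClassAt n hQm)

/-- **The package line HOLDS at `klEngGeo14` in the pair class.** -/
theorem klg14_package_ineq_of_isPairClassAt {Qm : TorusSite 2 L} (n : ℕ) (hQm : IsPairClassAt L Qm n) :
    klEngGeo14.aplus * klEngGeo14.ζ (n - 1) + 10 * klEngGeo14.bhi ≤ klEngGeo14.ppGain n (klTorusNorm L Qm) :=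
  GeoConsts.package_ineq_of_ppGain_le (klEngGeo13_ppGain_le_klEngGeo14_ppGain n _) klEngGeo14_aplus klEngGeo14_ζ klEngGeo14_bhi
    (klg13_package_ineq_of_isPairClassAt n hQm)

/-- `klEngGeo11.bhi = 2²⁴` (untouched since `klEngGeo3`). -/
theorem klEngGeo11_bhi_eq : klEngGeo11.bhi = 2 ^ 24 := rfl

/-- `klEngGeo13.bhi = 2²⁴`. -/
theorem klEngGeo13_bhi_eq : klEngGeo13.bhi = 2 ^ 24 := rfl

/-- `klEngGeo14.bhi = 2²⁴`. -/
theorem klEngGeo14_bhi_eq : klEngGeo14.bhi = 2 ^ 24 := rfl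

/-! ## §2 The closers at an arbitrary package `G` -/

section Model

variable {M : ℕ} [NeZero L] [NeZero M] {G : GeoConsts} {P : SplitConsts} {Q : EngConsts} {R : RenConsts} {c β U μ : ℝ} {n : ℕ}

/-- **In-class (E2″-F) at any package `G`** from the cured ladder clause (E2-F2)ₙ, the (B1-F) array at `n−1`, the two smallness lines and the package line at `G`. -/
theorem klvrF_pairValueIncrement_inClass_G (hbhi : 0 ≤ G.bhi) (hP : P.WF) (hQ : Q.WF) (hn : 1 ≤ n)
    (hlad : PairLadderStepAtV17F2 L M G P Q β U μ n) (harr : PairArrayAtV17F L M P Q β U μ (n - 1))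
    (hcU' : (P.C_W + klLegKappa * Q.CR * P.Klam ^ 3) * |U| ≤ 1 / 10) (hUb : |U| * G.bhi ≤ 1 / 8)
    (hpkg : ∀ Qm : TorusSite 2 L, IsPairClassAt L Qm n → G.aplus * G.ζ (n - 1) + 10 * G.bhi ≤ G.ppGain n (klTorusNorm L Qm))
    {Qm : TorusSite 2 L} (hQm : IsPairClassAt L Qm n) :
    ∀ k ∈ klBall L μ 0, ∀ k' ∈ klBall L μ 0,
      ‖klPairAmplitude L M β U μ (klFlowFrameU L M β U μ n) n Qm k k' -
          klPairAmplitude L M β U μ (klFlowFrameU L M β U μ (n - 1)) (n - 1) Qm k k'‖ ≤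
        gainBar G P U n (klTorusNorm L Qm) (klTorusNorm L (k - k')) (klTorusNorm L (k + k' - Qm)) +
          eremBar G P Q U β L (n - 1) + thermalBar G P U β n +
            legDressBarQ2 G P Q U n (legSliceCountT L β μ (klFlowFrameU L M β U μ n) n ![k', Qm - k', Qm - k, k]) +
              frameShiftBar P Q U n := by
  have hK : 1 ≤ P.Klam := hP.1
  have hcU : 0 ≤ P.C_W + klLegKappa * Q.CR * P.Klam ^ 3 := by
    have h1 : 0 ≤ P.C_W := hP.2.1
    have h2 : 0 ≤ klLegKappa * Q.CR * P.Klam ^ 3 :=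
      mul_nonneg (mul_nonneg (by unfold klLegKappa; norm_num) hQ.2.1) (pow_nonneg (zero_le_one.trans hK) 3)
    linarith
  exact klvrF_pairValueIncrement_inClass hn hlad harr hQm hK hbhi hcU hcU' hUb (hpkg Qm hQm)

/-- **THE (c)-F VALUE CONJUNCTS FROM THE REDUCED LIST AT ANY PACKAGE `G`**: (E2-F2)ₙ `hlad` AT `G`, the (B1-F) array at `n−1`, the OUT-OF-CLASS half of (E2″-F)ₙ AT `G`,
(E5-F)ₙ AT `G`, the two smallness lines (`(C_W + klLegKappa·Q.CR·Klam³)|U| ≤ 1/10`, `|U|·G.bhi ≤ 1/8`) and the package line at `G` ⇒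
`PairLadderStepAtV17F2 ∧ PairValueIncrementAtV17F ∧ QuarticValueIncrementAtV17F ∧ IsoTupleL1AtV17F` at `(G, Q, n)`. -/
theorem klvrF_stepValues_of_reduced_G (hbhi : 0 ≤ G.bhi) (hP : P.WF) (hQ : Q.WF) (hn : 1 ≤ n)
    (hlad : PairLadderStepAtV17F2 L M G P Q β U μ n) (harr : PairArrayAtV17F L M P Q β U μ (n - 1))
    (hcU' : (P.C_W + klLegKappa * Q.CR * P.Klam ^ 3) * |U| ≤ 1 / 10) (hUb : |U| * G.bhi ≤ 1 / 8)
    (hpkg : ∀ Qm : TorusSite 2 L, IsPairClassAt L Qm n → G.aplus * G.ζ (n - 1) + 10 * G.bhi ≤ G.ppGain n (klTorusNorm L Qm))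
    (hout : ∀ Qm : TorusSite 2 L, ¬ IsPairClassAt L Qm n → ∀ k ∈ klBall L μ 0, ∀ k' ∈ klBall L μ 0,
      ‖klPairAmplitude L M β U μ (klFlowFrameU L M β U μ n) n Qm k k' -
          klPairAmplitude L M β U μ (klFlowFrameU L M β U μ (n - 1)) (n - 1) Qm k k'‖ ≤
        gainBar G P U n (klTorusNorm L Qm) (klTorusNorm L (k - k')) (klTorusNorm L (k + k' - Qm)) +
          eremBar G P Q U β L (n - 1) + thermalBar G P U β n +
            legDressBarQ2 G P Q U n (legSliceCountT L β μ (klFlowFrameU L M β U μ n) n ![k', Qm - k', Qm - k, k]) +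
              frameShiftBar P Q U n)
    (hE5 : IsoTupleL1AtV17F L M G P β U μ n) :
    PairLadderStepAtV17F2 L M G P Q β U μ n ∧ PairValueIncrementAtV17F L M G P Q β U μ n ∧
      QuarticValueIncrementAtV17F L M G P Q β U μ n ∧ IsoTupleL1AtV17F L M G P β U μ n :=
  klvrF2_stepValues_of_parts hlad (fun _ hQm => klvrF_pairValueIncrement_inClass_G hbhi hP hQ hn hlad harr hcU' hUb hpkg hQm) hout hE5

/-- **Stub (c) at `(G, Q)` from its three residual inputs, HISTORY-keyed**: the (B1-F) array at `n−1` is read from `HistP klPredsV17F2 … G … 0 n`. -/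
theorem stepValuesV17F2_of_residue_G (hbhi : 0 ≤ G.bhi) (hP : P.WF) (hQ : Q.WF) (hn1 : 1 ≤ n)
    (hcU' : (P.C_W + klLegKappa * Q.CR * P.Klam ^ 3) * |U| ≤ 1 / 10) (hUb : |U| * G.bhi ≤ 1 / 8)
    (hpkg : ∀ Qm : TorusSite 2 L, IsPairClassAt L Qm n → G.aplus * G.ζ (n - 1) + 10 * G.bhi ≤ G.ppGain n (klTorusNorm L Qm))
    (hhist : HistP klPredsV17F2 L M G P Q R β U μ 0 n)
    (hlad : PairLadderStepAtV17F2 L M G P Q β U μ n)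
    (hout : ∀ Qm : TorusSite 2 L, ¬ IsPairClassAt L Qm n → ∀ k ∈ klBall L μ 0, ∀ k' ∈ klBall L μ 0,
      ‖klPairAmplitude L M β U μ (klFlowFrameU L M β U μ n) n Qm k k' -
          klPairAmplitude L M β U μ (klFlowFrameU L M β U μ (n - 1)) (n - 1) Qm k k'‖ ≤
        gainBar G P U n (klTorusNorm L Qm) (klTorusNorm L (k - k')) (klTorusNorm L (k + k' - Qm)) +
          eremBar G P Q U β L (n - 1) + thermalBar G P U β n +
            legDressBarQ2 G P Q U n (legSliceCountT L β μ (klFlowFrameU L M β U μ n) n ![k', Qm - k', Qm - k, k]) +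
              frameShiftBar P Q U n)
    (hE5 : IsoTupleL1AtV17F L M G P β U μ n) :
    PairLadderStepAtV17F2 L M G P Q β U μ n ∧ PairValueIncrementAtV17F L M G P Q β U μ n ∧
      QuarticValueIncrementAtV17F L M G P Q β U μ n ∧ IsoTupleL1AtV17F L M G P β U μ n := by
  have harr : PairArrayAtV17F L M P Q β U μ (n - 1) := (((histP_klPredsV17F2_iff L M G P Q R β U μ 0 n).1 hhist) (n - 1) (by omega)).1.1
  exact klvrF_stepValues_of_reduced_G hbhi hP hQ hn1 hlad harr hcU' hUb hpkg hout hE5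

/-- **The same with the out-of-class rows split into SAME-FRAME rows at `Kₙ` + the frame-shift door** (`klvrF_outClass_of_sameFrame_frameShift`). -/
theorem stepValuesV17F2_of_residue_sameFrame_G (hbhi : 0 ≤ G.bhi) (hP : P.WF) (hQ : Q.WF) (hn1 : 1 ≤ n)
    (hcU' : (P.C_W + klLegKappa * Q.CR * P.Klam ^ 3) * |U| ≤ 1 / 10) (hUb : |U| * G.bhi ≤ 1 / 8)
    (hpkg : ∀ Qm : TorusSite 2 L, IsPairClassAt L Qm n → G.aplus * G.ζ (n - 1) + 10 * G.bhi ≤ G.ppGain n (klTorusNorm L Qm))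
    (hhist : HistP klPredsV17F2 L M G P Q R β U μ 0 n)
    (hlad : PairLadderStepAtV17F2 L M G P Q β U μ n)
    (hsame : ∀ Qm : TorusSite 2 L, ¬ IsPairClassAt L Qm n → ∀ k ∈ klBall L μ 0, ∀ k' ∈ klBall L μ 0,
      ‖klPairAmplitude L M β U μ (klFlowFrameU L M β U μ n) n Qm k k' -
          klPairAmplitude L M β U μ (klFlowFrameU L M β U μ n) (n - 1) Qm k k'‖ ≤
        gainBar G P U n (klTorusNorm L Qm) (klTorusNorm L (k - k')) (klTorusNorm L (k + k' - Qm)) +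
          eremBar G P Q U β L (n - 1) + thermalBar G P U β n +
            legDressBarQ2 G P Q U n (legSliceCountT L β μ (klFlowFrameU L M β U μ n) n ![k', Qm - k', Qm - k, k]))
    (hshift : ∀ Qm : TorusSite 2 L, ¬ IsPairClassAt L Qm n → ∀ k ∈ klBall L μ 0, ∀ k' ∈ klBall L μ 0,
      ‖klPairAmplitude L M β U μ (klFlowFrameU L M β U μ n) (n - 1) Qm k k' -
          klPairAmplitude L M β U μ (klFlowFrameU L M β U μ (n - 1)) (n - 1) Qm k k'‖ ≤ frameShiftBar P Q U n)
    (hE5 : IsoTupleL1AtV17F L M G P β U μ n) :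
    PairLadderStepAtV17F2 L M G P Q β U μ n ∧ PairValueIncrementAtV17F L M G P Q β U μ n ∧
      QuarticValueIncrementAtV17F L M G P Q β U μ n ∧ IsoTupleL1AtV17F L M G P β U μ n :=
  stepValuesV17F2_of_residue_G hbhi hP hQ hn1 hcU' hUb hpkg hhist hlad (klvrF_outClass_of_sameFrame_frameShift hsame hshift) hE5

/-- **Stub (c) at `(G, Q)` with (E5-F)ₙ replaced by the iso door's inputs** (`isoTupleL1AtV17F_of_fixedTuple_le_hist` at `G`; `n ≤ n_β + 1`): the door's (E2″-F)ₙ input is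
derived from (E2-F2)ₙ (in class, package line at `G`) and `hout`. -/
theorem stepValuesV17F2_of_residue_towerLine_G (hG : G.WF) (hP : P.WF) (hQ : Q.WF) (hR : R.WF) (hU : 0 < U) (hn1 : 1 ≤ n) (hn : n ≤ nScales β + 1)
    (hcU' : (P.C_W + klLegKappa * Q.CR * P.Klam ^ 3) * |U| ≤ 1 / 10) (hUb : |U| * G.bhi ≤ 1 / 8)
    (hpkg : ∀ Qm : TorusSite 2 L, IsPairClassAt L Qm n → G.aplus * G.ζ (n - 1) + 10 * G.bhi ≤ G.ppGain n (klTorusNorm L Qm))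
    (hhist : HistP klPredsV17F2 L M G P Q R β U μ 0 n)
    (hlad : PairLadderStepAtV17F2 L M G P Q β U μ n)
    (hout : ∀ Qm : TorusSite 2 L, ¬ IsPairClassAt L Qm n → ∀ k ∈ klBall L μ 0, ∀ k' ∈ klBall L μ 0,
      ‖klPairAmplitude L M β U μ (klFlowFrameU L M β U μ n) n Qm k k' -
          klPairAmplitude L M β U μ (klFlowFrameU L M β U μ (n - 1)) (n - 1) Qm k k'‖ ≤
        gainBar G P U n (klTorusNorm L Qm) (klTorusNorm L (k - k')) (klTorusNorm L (k + k' - Qm)) +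
          eremBar G P Q U β L (n - 1) + thermalBar G P U β n +
            legDressBarQ2 G P Q U n (legSliceCountT L β μ (klFlowFrameU L M β U μ n) n ![k', Qm - k', Qm - k, k]) +
              frameShiftBar P Q U n)
    {a b : ℝ}
    (hfix : ∀ m : ℕ, n ≤ m → ∀ Ω ∈ bgmSectorSet L M (klIsoFamily L M β μ (klFlowFrameU L M β U μ n) klE0 m) 4,
      ∀ x₁ : SpaceTimeIdx L M,
        fixedTupleL1 L M β 3 (klIsoKernelAt L M β U μ (klFlowFrameU L M β U μ n) n m) Ω x₁ ≤ a * U + b * (P.Klam * U) ^ 2)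
    (ha : 2 * a ≤ G.CF) (hb : b ≤ G.CF)
    {q q₃ : TorusSite 2 L} (hq : q ∈ klBall L μ 0) (hq₃ : q₃ ∈ klBall L μ 0) (hqq : 4⁻¹ < klTorusNorm L (q + q₃))
    (hUκ : R.Gfr 0 * |U| ≤ 1 / 32 * klE0)
    (hsmall : initDevBar G U + legDressBarQ2 G P Q U 0 4 +
        (3 * G.CF * (P.Klam * U) ^ 2 +
          ((G.cloc * P.Klam ^ 2 * (1 - (4 : ℝ) ^ (-G.θ))⁻¹ + 2 * Q.CR * P.Klam ^ 3 * |U|) * U ^ 2 + ∑ j ∈ range n, Q.CL β j / L) +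
            7 / 3 * (G.CF * (P.Klam * U) ^ 2) + 20 * (Q.CR * ((P.Klam * U) ^ 2 + (P.Klam * |U|) ^ 3)) +
              4 / 3 * (Q.CR * (P.Klam * U) ^ 2)) ≤ U / 2) :
    PairLadderStepAtV17F2 L M G P Q β U μ n ∧ PairValueIncrementAtV17F L M G P Q β U μ n ∧
      QuarticValueIncrementAtV17F L M G P Q β U μ n ∧ IsoTupleL1AtV17F L M G P β U μ n := by
  have hbhi : 0 ≤ G.bhi := hG.2.2.1.trans hG.2.2.2.1
  have harr : PairArrayAtV17F L M P Q β U μ (n - 1) := (((histP_klPredsV17F2_iff L M G P Q R β U μ 0 n).1 hhist) (n - 1) (by omega)).1.1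
  have hE2'' : PairValueIncrementAtV17F L M G P Q β U μ n :=
    klvrF_pairValueIncrementAtV17F_of_inClass_outClass (fun Qm hQm => klvrF_pairValueIncrement_inClass_G hbhi hP hQ hn1 hlad harr hcU' hUb hpkg hQm) hout
  have hE5 : IsoTupleL1AtV17F L M G P β U μ n :=
    isoTupleL1AtV17F_of_fixedTuple_le_hist hG hP hQ hR hU hn1 hn hfix ha hb hhist hE2'' hq hq₃ hqq hUκ hsmall
  exact klvrF_stepValues_of_reduced_G hbhi hP hQ hn1 hlad harr hcU' hUb hpkg hout hE5

/-- **Thermal-band reading at any `G`**: `0 ≤ C`, `C·4^T ≤ G.CF`, `nScales β ≤ n + T`, `X ≤ C·(Klam U)²` ⇒ `X ≤ thermalBar G P U β n`. -/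
theorem band_le_thermalBar_G {C X : ℝ} {T : ℕ} (hC : 0 ≤ C) (hCT : C * 4 ^ T ≤ G.CF) (hband : nScales β ≤ n + T) (hX : X ≤ C * (P.Klam * U) ^ 2) :
    X ≤ thermalBar G P U β n := by
  unfold thermalBar
  have hK : 0 ≤ (P.Klam * U) ^ 2 := sq_nonneg _
  have hsub : nScales β - n ≤ T := by omega
  have h4 : ((4 : ℝ) ^ (nScales β - n)) ≤ 4 ^ T := pow_le_pow_right₀ (by norm_num) hsub
  have h4pos : 0 < (4 : ℝ) ^ (nScales β - n) := by positivity
  -- `C ≤ G.CF / 4^T ≤ G.CF / 4^{n_β − n}`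
  have hC' : C ≤ G.CF * ((4 : ℝ) ^ (nScales β - n))⁻¹ := by
    rw [← div_eq_mul_inv, le_div_iff₀ h4pos]
    calc C * (4 : ℝ) ^ (nScales β - n) ≤ C * 4 ^ T := mul_le_mul_of_nonneg_left h4 hC
      _ ≤ G.CF := hCT
  calc X ≤ C * (P.Klam * U) ^ 2 := hX
    _ ≤ G.CF * ((4 : ℝ) ^ (nScales β - n))⁻¹ * (P.Klam * U) ^ 2 := mul_le_mul_of_nonneg_right hC' hK
    _ = G.CF * (P.Klam * U) ^ 2 * ((4 : ℝ) ^ (nScales β - n))⁻¹ := by ring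

/-- **Stub (c) in the THERMAL BAND at any `G` from ONE sign-blind bound + (E5-F)ₙ** (`1 ≤ n`, `nScales β ≤ n + T`, `0 ≤ Cp`, `Cp·4^T ≤ G.CF`): no ladder data, no rows. -/
theorem stepValuesV17F2_band_of_le_CF_G (hG : G.WF) (hP : P.WF) (hQ : Q.WF) (hn1 : 1 ≤ n) {T : ℕ} (hband : nScales β ≤ n + T) {Cp : ℝ}
    (hCp : 0 ≤ Cp) (hCpT : Cp * 4 ^ T ≤ G.CF)
    (hpair : ∀ Qm : TorusSite 2 L, ∀ k ∈ klBall L μ 0, ∀ k' ∈ klBall L μ 0,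
      ‖klPairAmplitude L M β U μ (klFlowFrameU L M β U μ n) n Qm k k' -
          klPairAmplitude L M β U μ (klFlowFrameU L M β U μ (n - 1)) (n - 1) Qm k k'‖ ≤ Cp * (P.Klam * U) ^ 2)
    (hE5 : IsoTupleL1AtV17F L M G P β U μ n) :
    PairLadderStepAtV17F2 L M G P Q β U μ n ∧ PairValueIncrementAtV17F L M G P Q β U μ n ∧
      QuarticValueIncrementAtV17F L M G P Q β U μ n ∧ IsoTupleL1AtV17F L M G P β U μ n := by
  have hT : ∀ Qm : TorusSite 2 L, ∀ k ∈ klBall L μ 0, ∀ k' ∈ klBall L μ 0,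
      ‖klPairAmplitude L M β U μ (klFlowFrameU L M β U μ n) n Qm k k' -
          klPairAmplitude L M β U μ (klFlowFrameU L M β U μ (n - 1)) (n - 1) Qm k k'‖ ≤ thermalBar G P U β n :=
    fun Qm k hk k' hk' => band_le_thermalBar_G hCp hCpT hband (hpair Qm k hk k' hk')
  have h2 := klbandF_values_of_le_thermalBar hG hP hQ hT
  exact ⟨klbandF_pairLadderStepAtV17F2_of_le_thermalBar hG hP hQ hn1 (fun Qm _ k hk k' hk' => hT Qm k hk k' hk'), h2.1, h2.2, hE5⟩

end Model

/-! ## §3 Instances at `klEngGeo11` (token of record), `klEngGeo13`, `klEngGeo14` (A24 candidates) -/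

section Instances

variable {M : ℕ} [NeZero L] [NeZero M] {P : SplitConsts} {Q : EngConsts} {R : RenConsts} {β U μ : ℝ} {n : ℕ}

/-- **Stub (c) at `klEngGeo11` (the REGISTERED token), history-keyed**, smallness lines as hypotheses (`|U|·2²⁴ ≤ 1/8`). -/
theorem stepValuesV17F2_of_residue_klEngGeo11 (hP : P.WF) (hQ : Q.WF) (hn1 : 1 ≤ n)
    (hcU' : (P.C_W + klLegKappa * Q.CR * P.Klam ^ 3) * |U| ≤ 1 / 10) (hUb : |U| * 2 ^ 24 ≤ 1 / 8)
    (hhist : HistP klPredsV17F2 L M klEngGeo11 P Q R β U μ 0 n)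
    (hlad : PairLadderStepAtV17F2 L M klEngGeo11 P Q β U μ n)
    (hout : ∀ Qm : TorusSite 2 L, ¬ IsPairClassAt L Qm n → ∀ k ∈ klBall L μ 0, ∀ k' ∈ klBall L μ 0,
      ‖klPairAmplitude L M β U μ (klFlowFrameU L M β U μ n) n Qm k k' -
          klPairAmplitude L M β U μ (klFlowFrameU L M β U μ (n - 1)) (n - 1) Qm k k'‖ ≤
        gainBar klEngGeo11 P U n (klTorusNorm L Qm) (klTorusNorm L (k - k')) (klTorusNorm L (k + k' - Qm)) +
          eremBar klEngGeo11 P Q U β L (n - 1) + thermalBar klEngGeo11 P U β n +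
            legDressBarQ2 klEngGeo11 P Q U n (legSliceCountT L β μ (klFlowFrameU L M β U μ n) n ![k', Qm - k', Qm - k, k]) +
              frameShiftBar P Q U n)
    (hE5 : IsoTupleL1AtV17F L M klEngGeo11 P β U μ n) :
    PairLadderStepAtV17F2 L M klEngGeo11 P Q β U μ n ∧ PairValueIncrementAtV17F L M klEngGeo11 P Q β U μ n ∧
      QuarticValueIncrementAtV17F L M klEngGeo11 P Q β U μ n ∧ IsoTupleL1AtV17F L M klEngGeo11 P β U μ n :=
  stepValuesV17F2_of_residue_G (by rw [klEngGeo11_bhi_eq]; norm_num) hP hQ hn1 hcU' (by rw [klEngGeo11_bhi_eq]; exact hUb)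
    (fun _ hQm => klg11_package_ineq_of_isPairClassAt n hQm) hhist hlad hout hE5

/-- **Stub (c) at `klEngGeo13`, history-keyed.** -/
theorem stepValuesV17F2_of_residue_klEngGeo13 (hP : P.WF) (hQ : Q.WF) (hn1 : 1 ≤ n)
    (hcU' : (P.C_W + klLegKappa * Q.CR * P.Klam ^ 3) * |U| ≤ 1 / 10) (hUb : |U| * 2 ^ 24 ≤ 1 / 8)
    (hhist : HistP klPredsV17F2 L M klEngGeo13 P Q R β U μ 0 n)
    (hlad : PairLadderStepAtV17F2 L M klEngGeo13 P Q β U μ n)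
    (hout : ∀ Qm : TorusSite 2 L, ¬ IsPairClassAt L Qm n → ∀ k ∈ klBall L μ 0, ∀ k' ∈ klBall L μ 0,
      ‖klPairAmplitude L M β U μ (klFlowFrameU L M β U μ n) n Qm k k' -
          klPairAmplitude L M β U μ (klFlowFrameU L M β U μ (n - 1)) (n - 1) Qm k k'‖ ≤
        gainBar klEngGeo13 P U n (klTorusNorm L Qm) (klTorusNorm L (k - k')) (klTorusNorm L (k + k' - Qm)) +
          eremBar klEngGeo13 P Q U β L (n - 1) + thermalBar klEngGeo13 P U β n +
            legDressBarQ2 klEngGeo13 P Q U n (legSliceCountT L β μ (klFlowFrameU L M β U μ n) n ![k', Qm - k', Qm - k, k]) +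
              frameShiftBar P Q U n)
    (hE5 : IsoTupleL1AtV17F L M klEngGeo13 P β U μ n) :
    PairLadderStepAtV17F2 L M klEngGeo13 P Q β U μ n ∧ PairValueIncrementAtV17F L M klEngGeo13 P Q β U μ n ∧
      QuarticValueIncrementAtV17F L M klEngGeo13 P Q β U μ n ∧ IsoTupleL1AtV17F L M klEngGeo13 P β U μ n :=
  stepValuesV17F2_of_residue_G (by rw [klEngGeo13_bhi_eq]; norm_num) hP hQ hn1 hcU' (by rw [klEngGeo13_bhi_eq]; exact hUb)
    (fun _ hQm => klg13_package_ineq_of_isPairClassAt n hQm) hhist hlad hout hE5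

/-- **Stub (c) at `klEngGeo14`, history-keyed.** -/
theorem stepValuesV17F2_of_residue_klEngGeo14 (hP : P.WF) (hQ : Q.WF) (hn1 : 1 ≤ n)
    (hcU' : (P.C_W + klLegKappa * Q.CR * P.Klam ^ 3) * |U| ≤ 1 / 10) (hUb : |U| * 2 ^ 24 ≤ 1 / 8)
    (hhist : HistP klPredsV17F2 L M klEngGeo14 P Q R β U μ 0 n)
    (hlad : PairLadderStepAtV17F2 L M klEngGeo14 P Q β U μ n)
    (hout : ∀ Qm : TorusSite 2 L, ¬ IsPairClassAt L Qm n → ∀ k ∈ klBall L μ 0, ∀ k' ∈ klBall L μ 0,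
      ‖klPairAmplitude L M β U μ (klFlowFrameU L M β U μ n) n Qm k k' -
          klPairAmplitude L M β U μ (klFlowFrameU L M β U μ (n - 1)) (n - 1) Qm k k'‖ ≤
        gainBar klEngGeo14 P U n (klTorusNorm L Qm) (klTorusNorm L (k - k')) (klTorusNorm L (k + k' - Qm)) +
          eremBar klEngGeo14 P Q U β L (n - 1) + thermalBar klEngGeo14 P U β n +
            legDressBarQ2 klEngGeo14 P Q U n (legSliceCountT L β μ (klFlowFrameU L M β U μ n) n ![k', Qm - k', Qm - k, k]) +
              frameShiftBar P Q U n)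
    (hE5 : IsoTupleL1AtV17F L M klEngGeo14 P β U μ n) :
    PairLadderStepAtV17F2 L M klEngGeo14 P Q β U μ n ∧ PairValueIncrementAtV17F L M klEngGeo14 P Q β U μ n ∧
      QuarticValueIncrementAtV17F L M klEngGeo14 P Q β U μ n ∧ IsoTupleL1AtV17F L M klEngGeo14 P β U μ n :=
  stepValuesV17F2_of_residue_G (by rw [klEngGeo14_bhi_eq]; norm_num) hP hQ hn1 hcU' (by rw [klEngGeo14_bhi_eq]; exact hUb)
    (fun _ hQm => klg14_package_ineq_of_isPairClassAt n hQm) hhist hlad hout hE5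

/-- **The smallness line `|U|·2²⁴ ≤ 1/8` from `|U| ≤ 2⁻²⁷`** (any U-door below `2⁻²⁷`). -/
theorem abs_mul_two_pow_24_le_of_abs_le {U : ℝ} (h : |U| ≤ (2 : ℝ)⁻¹ ^ 27) : |U| * 2 ^ 24 ≤ 1 / 8 := by
  have := abs_nonneg U
  nlinarith

end Instances

end Summit.HubbardSuperconductivity.HubbardSuperconductivity.Theorems.KLRegimeSplit

end
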